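import Summits.CriticalPhenomena.PercolationContinuityZ3.Theorems.PercNearOneGluingNoHeavyLowerTailSahiC4CubeLeThree

/-!
# `NoHeavyLowerTail` (crux stmt-CriticalPhenomena-4575), master-family hierarchy P3: the TYPED level-4 comb statement (M⁺-4)
# — "every degree-4 tensor-Bernstein coefficient of `p ↦ E₄(μ_p; A,B,C,D)` is a nonnegative integer" — its meaning
# (the Bernstein expansion of `E₄`), what it implies (Sahi's `C₄` for product measures), and its kernel-proved case `m ≤ 3`

Support file (seat `prim-masterthm-p3`; `--supports stmt-CriticalPhenomena-4575`).  The one open statement is the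
`@[conjecture]`-tagged `SahiE4CombPositivity` (our conjecture = row (M⁺-4) of `run/shared/lean/prim/MASTER-FAMILY.md` §MASTER /
`run/shared/lean/prim/prim-masterthm/prim-masterthm-p3/HIERARCHY.md` §3; census: all quadruple-multisets of up-sets of `{0,1}^m`,
`m ≤ 4`, two independent programs, `2.79·10⁹` coefficients, `0` negative); everything else is proved:

* `e4Coef m a b c d k` — the integer level-4 comb coefficient of the bitmask quadruple `(a,b,c,d)` at the key `k : Fin m → Fin 5`
  (`= quarticCoef` of the fifteen-term table family of `…SahiC4CubeCertCheck`);
* `sahiE4_eq_quarticForm`, **`sahiE4_bernstein_expansion`** — for events `A,B,C,D ⊆ Set (Fin m)` and `p : Fin m → [0,1]`: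
  `E₄(prodBernoulli p; A,B,C,D) = Σ_k e4Coef(encA A,…,encA D; k) · Π_i p_i^{k_i} (1 − p_i)^{4−k_i}` — so `e4Coef` ARE the
  (unnormalised) tensor-Bernstein coefficients, and the conjecture below is a statement about Sahi's functional, not about our encoding;
* `SahiE4CombPositivity` (conjecture (M⁺-4)) and `SahiE4CombPositivityUpTo M` (its restriction to `m ≤ M`);
* `sahiE4_nonneg_of_combPositivity` — (M⁺-4) ⇒ Sahi's `C₄` for every product measure on every finite cube (the pointwise row (M-4));
* `e4Coef_nonneg_of_checkQuad` — the digit test of `…SahiC4CubeCertCheck` certifies ALL coefficients of one quadruple;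
* **`sahiE4CombPositivityUpTo_three`** — (M⁺-4) holds for `m ≤ 3`: KERNEL theorem (from the row-by-row evaluation
  `checkCube4_three` of `…SahiC4CubeLeThree`), strictly stronger than `sahiC4_cube_le_three`.
-/

namespace Summit.CriticalPhenomena.PercolationContinuityZ3.Theorems.SahiC4Cube

open Finset MeasureTheory OneCutCert FourCopyCert SahiC3Cube
open scoped BigOperators
open Literature.Probability.Percolation Literature.Probability.LatticeModels

/-! ## The level-4 comb coefficients of `E₄` -/

/-- The level-4 comb coefficient (unnormalised degree-4 tensor-Bernstein coefficient) of `E₄` of the bitmask quadruple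
`(a,b,c,d)` of the `m`-cube at the key `k`. [this work] -/
def e4Coef (m a b c d : ℕ) (k : Fin m → Fin 5) : ℤ :=
  quarticCoef sgn15 (X15 m a b c d) (Y15 m a b c d) (Z15 m a b c d) (W15 m d) k

/-- The fifteen-term quartic form of the tables is the `E₄`-quartic of the `ML`s. [this work] -/
theorem quarticForm_e4_eq (m a b c d : ℕ) (x : Fin m → ℝ) :
    quarticForm sgn15 (X15 m a b c d) (Y15 m a b c d) (Z15 m a b c d) (W15 m d) x =
      6 * ML (tabR m (a &&& b &&& c &&& d)) x
      - 2 * (ML (tabR m a) x * ML (tabR m (b &&& c &&& d)) x + ML (tabR m b) x * ML (tabR m (a &&& c &&& d)) x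
          + ML (tabR m c) x * ML (tabR m (a &&& b &&& d)) x + ML (tabR m d) x * ML (tabR m (a &&& b &&& c)) x)
      + (ML (tabR m a) x * ML (tabR m b) x * ML (tabR m (c &&& d)) x + ML (tabR m a) x * ML (tabR m c) x * ML (tabR m (b &&& d)) x
          + ML (tabR m a) x * ML (tabR m d) x * ML (tabR m (b &&& c)) x + ML (tabR m b) x * ML (tabR m c) x * ML (tabR m (a &&& d)) x
          + ML (tabR m b) x * ML (tabR m d) x * ML (tabR m (a &&& c)) x + ML (tabR m c) x * ML (tabR m d) x * ML (tabR m (a &&& b)) x)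
      - (ML (tabR m (a &&& b)) x * ML (tabR m (c &&& d)) x + ML (tabR m (a &&& c)) x * ML (tabR m (b &&& d)) x
          + ML (tabR m (a &&& d)) x * ML (tabR m (b &&& c)) x)
      - ML (tabR m a) x * ML (tabR m b) x * ML (tabR m c) x * ML (tabR m d) x := by
  unfold quarticForm
  simp only [Fin.sum_univ_succ, Fin.sum_univ_zero, sgn15, X15, Y15, Z15, W15, Matrix.cons_val_zero,
    Matrix.cons_val_succ]
  have h1 : ML (fun g => ((tabZ m (fullN m) g : ℤ) : ℝ)) x = 1 := ML_fullN m x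
  rw [h1]
  unfold tabR
  push_cast
  ring

/-- `E₄` under a product measure is the fifteen-term quartic form of the bitmask tables. [this work] -/
theorem sahiE4_eq_quarticForm {m : ℕ} (p : Fin m → unitInterval) (A B C D : Set (Set (Fin m))) :
    sahiE4 (prodBernoulli p) A B C D =
      quarticForm sgn15 (X15 m (encA m A) (encA m B) (encA m C) (encA m D)) (Y15 m (encA m A) (encA m B) (encA m C) (encA m D))
        (Z15 m (encA m A) (encA m B) (encA m C) (encA m D)) (W15 m (encA m D)) (fun i => (p i : ℝ)) := by
  classical
  rw [quarticForm_e4_eq, sahiE4_def]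
  have e : ∀ X : Set (Set (Fin m)), (prodBernoulli p).real X = ML (tabR m (encA m X)) (fun i => (p i : ℝ)) :=
    real_eq_ML_cube p
  simp only [e, tabR_encA_inter, tabR_land]

/-- **The degree-4 tensor-Bernstein expansion of `E₄`**: for events of the cube under `prodBernoulli p`,
`E₄(A,B,C,D) = Σ_k e4Coef(k) · Π_i p_i^{k_i}(1 − p_i)^{4 − k_i}`. [this work] -/
theorem sahiE4_bernstein_expansion {m : ℕ} (p : Fin m → unitInterval) (A B C D : Set (Set (Fin m))) :
    sahiE4 (prodBernoulli p) A B C D =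
      ∑ k : Fin m → Fin 5, (e4Coef m (encA m A) (encA m B) (encA m C) (encA m D) k : ℝ) * ∏ i, bern5 (p i : ℝ) (k i) := by
  rw [sahiE4_eq_quarticForm, quarticForm_eq]
  rfl

/-! ## The conjecture (M⁺-4) and what it gives -/

/-- **(M⁺-4) Level-4 comb positivity of Sahi's `E₄`** (this work / MASTER-FAMILY.md §MASTER; OPEN): for every finite cube and
all increasing events `A, B, C, D ⊆ Set (Fin m)`, every degree-4 tensor-Bernstein coefficient of `p ↦ E₄(prodBernoulli p; A,B,C,D)`
is `≥ 0` (`sahiE4_bernstein_expansion` identifies `e4Coef` with these coefficients).  Census: all quadruple-multisets of up-sets,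
`m ≤ 4` (ttrl2 `e4_comb.c` + prim-sahi `sahicomb.c`, `2.79·10⁹` coefficients), `0` negative; `m ≤ 3` is the kernel theorem
`sahiE4CombPositivityUpTo_three` below.  An obligation of our theories, never a fact: use as `(h : SahiE4CombPositivity)`.
[status: open] -/
@[conjecture] def SahiE4CombPositivity : Prop :=
  ∀ (m : ℕ) (A B C D : Set (Set (Fin m))), IsUpperSet A → IsUpperSet B → IsUpperSet C → IsUpperSet D →
    ∀ k : Fin m → Fin 5, 0 ≤ e4Coef m (encA m A) (encA m B) (encA m C) (encA m D) k

/-- (M⁺-4) restricted to cubes of dimension `≤ M`. [this work] -/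
def SahiE4CombPositivityUpTo (M : ℕ) : Prop :=
  ∀ (m : ℕ), m ≤ M → ∀ (A B C D : Set (Set (Fin m))), IsUpperSet A → IsUpperSet B → IsUpperSet C → IsUpperSet D →
    ∀ k : Fin m → Fin 5, 0 ≤ e4Coef m (encA m A) (encA m B) (encA m C) (encA m D) k

/-- Coefficientwise nonnegativity gives `E₄ ≥ 0` (one quadruple). [this work] -/
theorem sahiE4_nonneg_of_e4Coef_nonneg {m : ℕ} (p : Fin m → unitInterval) {A B C D : Set (Set (Fin m))}
    (h : ∀ k : Fin m → Fin 5, 0 ≤ e4Coef m (encA m A) (encA m B) (encA m C) (encA m D) k) :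
    0 ≤ sahiE4 (prodBernoulli p) A B C D := by
  rw [sahiE4_eq_quarticForm]
  exact quarticForm_nonneg h (fun i => ⟨(p i).2.1, (p i).2.2⟩)

/-- **(M⁺-4) ⇒ (M-4)**: level-4 comb positivity implies Sahi's `C₄` for every product measure on every finite cube. [this work] -/
theorem sahiE4_nonneg_of_combPositivity (h : SahiE4CombPositivity) {m : ℕ} (p : Fin m → unitInterval)
    {A B C D : Set (Set (Fin m))} (hA : IsUpperSet A) (hB : IsUpperSet B) (hC : IsUpperSet C) (hD : IsUpperSet D) :
    0 ≤ sahiE4 (prodBernoulli p) A B C D :=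
  sahiE4_nonneg_of_e4Coef_nonneg p (h m A B C D hA hB hC hD)

/-- The bounded form likewise. [this work] -/
theorem sahiE4_nonneg_of_combPositivityUpTo {M m : ℕ} (h : SahiE4CombPositivityUpTo M) (hm : m ≤ M)
    (p : Fin m → unitInterval) {A B C D : Set (Set (Fin m))} (hA : IsUpperSet A) (hB : IsUpperSet B) (hC : IsUpperSet C)
    (hD : IsUpperSet D) : 0 ≤ sahiE4 (prodBernoulli p) A B C D :=
  sahiE4_nonneg_of_e4Coef_nonneg p (h m hm A B C D hA hB hC hD)

/-! ## The digit test certifies all coefficients; the kernel case `m ≤ 3` -/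

/-- **The check certifies every coefficient**: if `checkQuad σ m a b c d = true` then all `5^m` level-4 comb coefficients of
the quadruple are `≥ 0`. [this work] -/
theorem e4Coef_nonneg_of_checkQuad {σ m a b c d : ℕ} (h : checkQuad σ m a b c d = true) :
    ∀ k : Fin m → Fin 5, 0 ≤ e4Coef m a b c d k := by
  unfold checkQuad checkQuadW at h
  simp only [Bool.and_eq_true, decide_eq_true_eq] at h
  obtain ⟨⟨hσ, hbnd⟩, hZ, hland⟩ := h
  unfold offM at hZ hland
  rw [Int.toNat_natCast] at hland
  have hZeq : zE4 σ m (krT5 σ m (fullN m)) a b c d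
      = quarticZ (2 ^ σ) sgn15 (X15 m a b c d) (Y15 m a b c d) (Z15 m a b c d) (W15 m d) := by
    unfold zE4 quarticZ
    simp only [Fin.sum_univ_succ, Fin.sum_univ_zero, sgn15, X15, Y15, Z15, W15, Matrix.cons_val_zero,
      Matrix.cons_val_succ, krT5_eq]
    ring
  have hB : CoefBound4 sgn15 (X15 m a b c d) (Y15 m a b c d) (Z15 m a b c d) (W15 m d) (2 ^ (σ - 1)) := by
    intro k
    have hX : ∀ j g, |X15 m a b c d j g| ≤ 1 := by intro j g; fin_cases j <;> exact abs_tabZ_le _ _ _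
    have hY : ∀ j g, |Y15 m a b c d j g| ≤ 1 := by intro j g; fin_cases j <;> exact abs_tabZ_le _ _ _
    have hZ' : ∀ j g, |Z15 m a b c d j g| ≤ 1 := by intro j g; fin_cases j <;> exact abs_tabZ_le _ _ _
    have hW : ∀ j g, |W15 m d j g| ≤ 1 := by intro j g; fin_cases j <;> exact abs_tabZ_le _ _ _
    have h16 : ∀ j, |sgn15 j * pcoef4 (X15 m a b c d j) (Y15 m a b c d j) (Z15 m a b c d j) (W15 m d j) k|
        ≤ |sgn15 j| * 16 ^ m := by
      intro j
      rw [abs_mul]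
      exact mul_le_mul_of_nonneg_left (abs_pcoef4_le _ _ _ _ (hX j) (hY j) (hZ' j) (hW j) k) (abs_nonneg _)
    have hsum : |quarticCoef sgn15 (X15 m a b c d) (Y15 m a b c d) (Z15 m a b c d) (W15 m d) k| ≤ 24 * 16 ^ m := by
      unfold quarticCoef
      calc |∑ j : Fin 15, sgn15 j * pcoef4 (X15 m a b c d j) (Y15 m a b c d j) (Z15 m a b c d j) (W15 m d j) k|
          ≤ ∑ j : Fin 15, |sgn15 j * pcoef4 (X15 m a b c d j) (Y15 m a b c d j) (Z15 m a b c d j) (W15 m d j) k| :=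
            Finset.abs_sum_le_sum_abs _ _
        _ ≤ ∑ j : Fin 15, |sgn15 j| * (16 : ℤ) ^ m := Finset.sum_le_sum fun j _ => h16 j
        _ = 24 * 16 ^ m := by
            simp only [Fin.sum_univ_succ, Fin.sum_univ_zero, sgn15, Matrix.cons_val_zero, Matrix.cons_val_succ]
            norm_num; ring
    have hpow : (24 : ℤ) * 16 ^ m < (2 : ℕ) ^ (σ - 1) := by exact_mod_cast hbnd
    exact lt_of_le_of_lt hsum hpow
  set N : ℕ := (zE4 σ m (krT5 σ m (fullN m)) a b c d + maskN σ (5 ^ m)).toNat with hN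
  have hNZ : (N : ℤ) = quarticZ (2 ^ σ) sgn15 (X15 m a b c d) (Y15 m a b c d) (Z15 m a b c d) (W15 m d) +
      ∑ j : Fin (5 ^ m), (2 : ℤ) ^ (σ - 1) * (2 ^ σ) ^ (j : ℕ) := by
    rw [hN, Int.toNat_of_nonneg hZ, hZeq, maskN_eq_sum σ hσ, Fin.sum_univ_eq_sum_range
      (fun j => (2 : ℤ) ^ (σ - 1) * (2 ^ σ) ^ j) (5 ^ m)]
  have hdig : ∀ j : ℕ, j < 5 ^ m → 2 ^ (σ - 1) ≤ digit (2 ^ σ) N j := digit_ge_of_land σ hσ (5 ^ m) N hland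
  exact quarticCoef_nonneg_of_digit_ge hσ hB N hNZ hdig

/-! ## Symmetry of the check under permuting the four bitmasks (so that sorted quadruples suffice) -/

/-- `a &&& c &&& b = a &&& b &&& c`. [folklore] -/
theorem land_right_comm (a b c : ℕ) : a &&& c &&& b = a &&& b &&& c := by
  rw [Nat.land_assoc, Nat.land_comm c b, ← Nat.land_assoc]

/-- The certificate number is symmetric in the first two bitmasks. [this work] -/
theorem zE4_comm₁₂ (σ m : ℕ) (F : ℤ) (a b c d : ℕ) : zE4 σ m F a b c d = zE4 σ m F b a c d := by
  unfold zE4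
  dsimp only
  rw [Nat.land_comm b a]
  ring

/-- The certificate number is symmetric in the middle two bitmasks. [this work] -/
theorem zE4_comm₂₃ (σ m : ℕ) (F : ℤ) (a b c d : ℕ) : zE4 σ m F a b c d = zE4 σ m F a c b d := by
  unfold zE4
  dsimp only
  rw [Nat.land_comm c b, land_right_comm a b c]
  ring

/-- The certificate number is symmetric in the last two bitmasks. [this work] -/
theorem zE4_comm₃₄ (σ m : ℕ) (F : ℤ) (a b c d : ℕ) : zE4 σ m F a b c d = zE4 σ m F a b d c := by
  unfold zE4
  dsimp only
  rw [Nat.land_comm d c, land_right_comm b c d, land_right_comm a c d, land_right_comm (a &&& b) c d]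
  ring

/-- `checkQuad` is symmetric in the first two bitmasks. [this work] -/
theorem checkQuad_comm₁₂ (σ m a b c d : ℕ) : checkQuad σ m a b c d = checkQuad σ m b a c d := by
  unfold checkQuad checkQuadW
  rw [zE4_comm₁₂]

/-- `checkQuad` is symmetric in the middle two bitmasks. [this work] -/
theorem checkQuad_comm₂₃ (σ m a b c d : ℕ) : checkQuad σ m a b c d = checkQuad σ m a c b d := by
  unfold checkQuad checkQuadW
  rw [zE4_comm₂₃]

/-- `checkQuad` is symmetric in the last two bitmasks. [this work] -/
theorem checkQuad_comm₃₄ (σ m a b c d : ℕ) : checkQuad σ m a b c d = checkQuad σ m a b d c := by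
  unfold checkQuad checkQuadW
  rw [zE4_comm₃₄]

/-- A passing cube check certifies EVERY (not only sorted) quadruple of increasing bitmasks. [this work] -/
theorem checkQuad_of_checkCube4_mem {m σ : ℕ} (h : checkCube4 m σ = true) {a b c d : ℕ} (ha : a ∈ upsN m)
    (hb : b ∈ upsN m) (hc : c ∈ upsN m) (hd : d ∈ upsN m) : checkQuad σ m a b c d = true := by
  let P : {x : ℕ // x ∈ upsN m} → {x : ℕ // x ∈ upsN m} → {x : ℕ // x ∈ upsN m} → {x : ℕ // x ∈ upsN m} → Prop :=
    fun a b c d => checkQuad σ m a.1 b.1 c.1 d.1 = true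
  have key : P ⟨a, ha⟩ ⟨b, hb⟩ ⟨c, hc⟩ ⟨d, hd⟩ := by
    refine forall_of_sorted₄ P (fun x => x.1) ?_ ?_ ?_ ?_ ⟨a, ha⟩ ⟨b, hb⟩ ⟨c, hc⟩ ⟨d, hd⟩
    · intro a b c d habcd; simp only [P] at habcd ⊢; rwa [checkQuad_comm₁₂]
    · intro a b c d habcd; simp only [P] at habcd ⊢; rwa [checkQuad_comm₂₃]
    · intro a b c d habcd; simp only [P] at habcd ⊢; rwa [checkQuad_comm₃₄]
    · intro a b c d hab hbc hcd
      exact checkQuad_of_checkCube4 h a.2 b.2 c.2 d.2 hab hbc hcd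
  exact key

/-- A passing cube check certifies every coefficient of every increasing quadruple of that dimension. [this work] -/
theorem e4Coef_nonneg_of_checkCube4 {m σ : ℕ} (h : checkCube4 m σ = true) {A B C D : Set (Set (Fin m))}
    (hA : IsUpperSet A) (hB : IsUpperSet B) (hC : IsUpperSet C) (hD : IsUpperSet D) :
    ∀ k : Fin m → Fin 5, 0 ≤ e4Coef m (encA m A) (encA m B) (encA m C) (encA m D) k :=
  e4Coef_nonneg_of_checkQuad (checkQuad_of_checkCube4_mem h (encA_mem_upsN hA) (encA_mem_upsN hB) (encA_mem_upsN hC)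
    (encA_mem_upsN hD))

/-- **(M⁺-4) holds on every cube of dimension `≤ 3`** — KERNEL theorem: all degree-4 tensor-Bernstein coefficients of
`p ↦ E₄(prodBernoulli p; A,B,C,D)` are `≥ 0` for all increasing `A,B,C,D ⊆ Set (Fin m)`, `m ≤ 3`. [this work] -/
theorem sahiE4CombPositivityUpTo_three : SahiE4CombPositivityUpTo 3 := by
  intro m hm A B C D hA hB hC hD
  interval_cases m
  · exact e4Coef_nonneg_of_checkCube4 checkCube4_zero hA hB hC hD
  · exact e4Coef_nonneg_of_checkCube4 checkCube4_one hA hB hC hD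
  · exact e4Coef_nonneg_of_checkCube4 checkCube4_two hA hB hC hD
  · exact e4Coef_nonneg_of_checkCube4 checkCube4_three hA hB hC hD

end Summit.CriticalPhenomena.PercolationContinuityZ3.Theorems.SahiC4Cube
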